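import Literature.MathematicalPhysics.QuantumFieldTheory.Balaban1983to89.B9Eq3152RkGpDstarPiTwoBackgroundLetterTower
import Literature.MathematicalPhysics.QuantumFieldTheory.Balaban1983to89.B9Eq3152StoreyHClosedOnModel
import Literature.MathematicalPhysics.QuantumFieldTheory.Balaban1983to89.B9Thm34TowerVacuumLadderGradient

/-!
# `Balaban1983to89.B9Eq3152ThirdWordPiTwoBackgroundLetterTower` — T. Bałaban, *Propagators for lattice gauge theories in a background field*, Commun. Math. Phys. **99** (1985) 389–434
# [Balaban1985BackgroundPropagators] (3.153) p. 426 *«𝔊 = G₁ − G₁DRD\*G₁ − G₁Q\*(QG₁Q\*)⁻¹QG₁»* with (3.150)∕(3.152) p. 426 (*«G₁DR = DG′R»*, the third word `DG′RG′D\*`), (3.122) p. 420, Thm 3.4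
# p. 400, Thm 3.1 (3.42) p. 397, (3.3) p. 391, with [Balaban1985Variational] (110)–(111) p. 294, (117) p. 295: **THE THIRD WORD `G̃_kD_UR_kD*_UG̃_k = D_UG′_kR_kG′_kD*_U` OF PRINT's
# `𝔊̃_k`, TWO-BACKGROUND LADDER AT THE FLAT BASE, VALUE MEMBER** — for one-block fine-bond sources `f` over the coarse block `v` with `‖f‖_∞ ≤ F` and every fine bond `b`:
# `‖((G̃_k(U)D_UR_k(U)D*_UG̃_k(U) − G_k(1)D_1R_k(1)D*_1G_k(1))f)(b)‖ ≤ (j₀ + α)·K·e^{−κ·d_m(Π(b₋), v)}·F`, constants BEFORE `n, η, m, U` — by (3.152) both sides are `DG′RG′D*` words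
# (`G̃_k(1) = G_k(1)`); with `ω = R_kG′_kD*f`, `u = G′_kω`: `D_Uu(U) − D_1u(1) = (D_U − D_1)u(U) + D_1(G′_k(U) − G′_k(1))ω(U) + D_1G′_k(1)(ω(U) − ω(1))` — the transporter difference on gen 95's
# (HR) value row of `u`, gen 99's GRADIENT ladder of `G′_k` read back as a letter on the (HR) row of `ω`, the flat-base gradient majorant of `G′_k(1)` on this generation's two-background
# letter of `ω` (`B9Eq3152RkGpDstarPiTwoBackgroundLetterTower`)

statement-level skeleton of published theorems with citation tags; proofs where landed; nothing here is a claim about the Yang–Mills mass gap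

CITATION HEADER (lean-in-tree rule).  Audit cell `pub-balaban`, sub-cell `t4`, BINDER row NE9; filed by NE9 crux-team LEAF PROVER 01 (`b2b-balaban-t4-ne9-formalise-leaf-01`, gen 102;
ROUTE (J′), π-side, the `𝔊̃` storey (third word); bears_on: R4/N22).  Composition BY NAME: this generation's `B9Eq3152RkGpDstarPiTwoBackgroundLetterTower.exists_letter_RkGpDstar_sub_flat`;
gen 95's `B9Eq3152StoreyHClosedOnModel.rows_RkGpDstar_GpOfUk_hold` ((HR): the value rows of `ω`, `u` on the MODEL — O-NE9-1, #5 UNRULED); gen 99's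
`B9Thm34TowerVacuumLadderGradient.exists_hasMajorant_diffLetter_GpOfUk_sub_flat` and `B9Eq342TowerFlatBaseMajorants.exists_hasMajorants_GpOfUk_one` read back by gen 100's seam
`B9Eq368TowerProjWordGradientLetters.gradRowW_of_hasMajorant_conj_gradLetterF_readA`; gen 92's `B9Eq3152GtildeThirdWordTwoSided.thirdWord_G1LatticeKPi_eq`; ne9-leaf-03's
`B9Eq3119DeltaPiTowerFlat.{laplaceAkPi_one_pos_iff, letters_laplaceAkPi_one}`; ne9-leaf-04's `B9Eq373TransporterLipschitzLetters.norm_adTransportW_sub_adTransportW_le`; ne9-leaf-05's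
`B9Eq326G1SupRowOfLetters.{letter_comp, letter_add}`, `B9Eq33CovDerivLocalLetterTower.tdist_bigBlock_bpos_btgt_le_one`.  Source READ first-hand in the held text layer
`paper:balaban1985-cmp99-background-propagators` (journal page = PDF page + 388) pp. 391, 397, 400, 420, 425–426.  NOTHING of print's proofs is reproduced: [folklore] telescoping + letter
compositions.

WHAT IS PROVED (sorry-free; proof lane — 0 `def`; [folklore]).
* **`exists_letter_thirdWordPi_sub_flat`** — `∃ α₁ j₁ > 0, K ≥ 0, κ > 0` BEFORE the binder block of `B9Eq3130GtildeTwoBackgroundLetterTower.exists_letters_G1kPi_sub_flat` VERBATIM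
  (fine-bond one-block sources `f`, output fine bonds `b`): `‖((G̃_k(U)D_UR_k(U)D*_UG̃_k(U) − G_k(1)D_1R_k(1)D*_1G_k(1))f)(b)‖ ≤ (j₀ + α)·K·e^{−κ·d_m(Π(b₋),v)}·F` (the tip row
  re-blocked to the base at the cost `e^{κ}`).
HONEST SCOPE.  Composition BY NAME on the cell's MODEL rows (O-NE9-1, #5 UNRULED); constants crude; VALUE member only — the GRADIENT member `∇_1` of this word between two backgrounds is the
flat Hessian of `u(U) − u(1)` and needs η-scale Hölder ∕ Hessian rows of `G′_k` BETWEEN TWO BACKGROUNDS (Thm 3.4 for (3.43)₂∕(3.44)), NOT in the tree (LOCATED); `j₀` and `α` displayed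
separately; the windows, `c₀ = η^d`, unitarity, the tower data, `hαL`, the positivity and onto witnesses stay HYPOTHESES; nothing of [B9] (3.152)–(3.153) ∕ Thm 3.4 or [B11] (117) asserted as
printed; «NE9 ⇐ the named binders»; NE9 NOT PRINTED ∕ NOT PROVED; spine PROVED 0∕9; rung (B)+1 on a finite T⁴ — NOT infinite volume, NOT mass gap, NOT BetaPertH, NOT Clay.  HONEST DEPENDENCY:
continuum YM on T⁴ ⇐ BetaPertH ∧ nine spine estimates (0/9 proved); BetaPertH ⇐ (D1) ∧ (D4) ∧ CAP+tail; G-an2-4 gates asym, D1 and NE2/3/4.  NEW file; nothing modified.  Net new unproved facts: 0.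
-/

noncomputable section

open scoped InnerProductSpace ComplexConjugate BigOperators

namespace Literature.MathematicalPhysics.QuantumFieldTheory.Balaban1983to89.B9Eq3152ThirdWordPiTwoBackgroundLetterTower

open B4Sect5Torus (TSite tdist tdist_nonneg tdist_triangle tdist_symm torusSum_le tdist_self)
open B4Sect5Proof (latticeConst latticeConst_nonneg)
open B9SectCLatticeCarrier (Bond bpos btgt shift unshift)
open B9Eq311L2Pairing (WL2)
open B9Eq319QprimeTorus (blockCoord)
open B7Prop1Explicit (U1 Wcx boxVec)
open B11Eq103H1Complex (SiteL2K BondL2K covDerivL2K covDivL2K G1LatticeK equiv_covDerivL2K)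
open B9Eq33CovDerivVector (covDeriv_apply)
open B9Eq310DeltaPrime (plaqHolU plaqHolU_one)
open B9Eq310HessianOperator (adTransportW)
open B9Eq315QTorus (perCfg cornerSite)
open B9Eq315QTower (towerP UlevOf)
open B9Eq315QTowerFlat (perCfg_UlevOf_one_mem_U1 norm_Wcx_UlevOf_one_sub_one_le UlevOf_one)
open B9Eq316TowerFlatIsOneStep (towerP_eq_fineP_pow siteCast)
open B9Eq326OperatorTower (QkW laplaceAk G1k RofUk QkW_surjective)
open B9Eq324DeltaPrimeATower (laplacePrimeAk GpOfUk)
open B9Eq3119DeltaPiTower (laplaceAkPi)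
open B9Eq3119DeltaPiTowerFlat (laplaceAkPi_one_pos_iff letters_laplaceAkPi_one)
open B9Eq326G1SupRowOfLetters (letter_comp letter_add)
open B9Eq3152StoreyHClosedOnModel (rows_RkGpDstar_GpOfUk_hold)
open B9Eq3152RkGpDstarPiTwoBackgroundLetterTower (exists_letter_RkGpDstar_sub_flat)
open B9Thm34TowerVacuumLadderGradient (exists_hasMajorant_diffLetter_GpOfUk_sub_flat)
open B9Eq342TowerFlatBaseMajorants (exists_hasMajorants_GpOfUk_one)
open B9Eq3152GtildeThirdWordTwoSided (thirdWord_G1LatticeKPi_eq)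
open B9Eq368TowerProjWordGradientLetters (tdist_le_tdist1 gradRowW_of_hasMajorant_conj_gradLetterF_readA)
open B9Eq352DivFormLetters (conj_sub)
open B9Eq352GradLetters (diffLetter_inl)
open B9Eq324PenaltyKernelForm (readA_sub)
open B9Eq341TowerBlockGeometry (towerGeom dist_towerGeom len_towerGeom blkK_eq_blockCoord_siteCast)
open B9Eq357QprimeTowerKernelForm (blkK)
open B9Thm34Ext (toB6)
open B9Eq373TransporterLipschitzLetters (norm_adTransportW_sub_adTransportW_le)
open B9Eq33CovDerivLocalLetterTower (tdist_bigBlock_bpos_btgt_le_one)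

variable {d : ℕ} (hd : 1 ≤ d) (L : ℕ) [NeZero L] (hL : 1 ≤ L) (hL3 : 3 ≤ L)
  {𝔸 : Type*} [NormedRing 𝔸] [NormedAlgebra ℂ 𝔸] [CompleteSpace 𝔸] [NormOneClass 𝔸] [StarRing 𝔸] [NormedStarGroup 𝔸] [StarModule ℂ 𝔸] [FiniteDimensional ℂ 𝔸]
  {W : Type*} [NormedAddCommGroup W] [InnerProductSpace ℂ W] [FiniteDimensional ℂ W] (φ : W ≃ₗ[ℂ] 𝔸)
  {Mφ Mφ' : ℝ} (hMφ : 0 ≤ Mφ) (hMφ' : 0 ≤ Mφ') (hφ : ∀ w, ‖φ w‖ ≤ Mφ * ‖w‖) (hφ' : ∀ X, ‖φ.symm X‖ ≤ Mφ' * ‖X‖) (hstar : ∀ X : 𝔸, ‖star X‖ ≤ ‖X‖)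
  {a : ℝ} (ha : 0 < a) {a' : ℝ} (ha' : 0 < a') {ϱ : ℝ} (hϱ0 : 0 ≤ ϱ) (hϱ1 : ϱ < 1)
  (τ : 𝔸 →ₗ[ℂ] ℂ) {Cτ : ℝ} (hτ : ∀ X, ‖τ X‖ ≤ Cτ * ‖X‖) (hCτ : 0 ≤ Cτ) {Mτ : ℝ} (hτm : ∀ X Y : 𝔸, ‖τ (X * Y)‖ ≤ Mτ * ‖X‖ * ‖Y‖) (hMτ : 0 ≤ Mτ)
  {ρw : ℝ} (hρw : 0 ≤ ρw)
  (hτ₁ : ∀ X : 𝔸, τ (star X) = conj (τ X)) (hτ₂ : ∀ X Y : 𝔸, τ (X * Y) = τ (Y * X)) (hφτ : ∀ X Y : 𝔸, ⟪φ.symm X, φ.symm Y⟫_ℂ = τ (star X * Y))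
  (AQ : ℝ)
  {ι : Type} [Fintype ι] [DecidableEq ι] (b : Module.Basis ι ℝ 𝔸) {M₂ : ℝ} (hM₂ : 0 ≤ M₂) (hrepr : ∀ (v : 𝔸) (i : ι), |b.repr v i| ≤ M₂ * ‖v‖)

include hd hL hL3 hMφ hMφ' hφ hφ' hstar ha ha' hϱ0 hϱ1 hτ hCτ hτm hMτ hρw hτ₁ hτ₂ hφτ hM₂ hrepr in
set_option maxHeartbeats 3200000 in
set_option maxRecDepth 8192 in
/-- **THE THIRD WORD `G̃_kD_UR_kD*_UG̃_k` OF PRINT's `𝔊̃_k`, TWO-BACKGROUND LADDER AT THE FLAT BASE, VALUE MEMBER** — see the module docstring. [folklore]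
[cite: Balaban1985BackgroundPropagators, (3.152)–(3.153) p.426, (3.150) p.426, (3.122) p.420, Thm 3.4 p.400, Thm 3.1 (3.42) p.397, (3.3) p.391; Balaban1985Variational, (110)–(111) p.294, (117) p.295] -/
theorem exists_letter_thirdWordPi_sub_flat :
    ∃ α₁ j₁ K κ : ℝ, 0 < α₁ ∧ 0 < j₁ ∧ 0 ≤ K ∧ 0 < κ ∧
      ∀ (n : ℕ) (η : ℝ) (_hηL : η * (L : ℝ) ^ (n + 1) = 1) (c₀ c₁ : ℝ) [Fact (0 < c₀)] [Fact (0 < c₁)]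
        (_hw : c₀ * ((L : ℝ) ^ (n + 1)) ^ d = c₁) (_hρ : |η| ^ d / c₀ ≤ ρw) (m : Fin d → ℕ) [∀ i, NeZero (m i)] (_hm : ∀ i, 1 ≤ m i)
        (U : Bond d (towerP L m (n + 1)) → 𝔸ˣ) (αU : ℕ → ℝ) (_hα0 : ∀ j, 0 ≤ αU j) (hα1 : ∀ j, αU j ≤ 1 / 64)
        (_hαL : ∀ j, 50 * (d + 1) * αU j * (L : ℝ) ^ d ≤ 1 / 2)
        (hU1 : ∀ (j : ℕ) (x : B7Prop1Explicit.Site d) (k : Fin d), perCfg (towerP L m (j + 1)) (UlevOf L m (n + 1) U j) x k ∈ U1 𝔸)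
        (hreg : ∀ (j : ℕ) (y : TSite d (towerP L m j)) (k : Fin d) (ρ' : Fin d → Fin L),
          ‖((Wcx L (perCfg (towerP L m (j + 1)) (UlevOf L m (n + 1) U j)) (cornerSite L y) k (boxVec L ρ') : 𝔸ˣ) : 𝔸) - 1‖ ≤ αU j)
        (εU : ℕ → ℝ) (_hεU : ∀ j, 0 ≤ εU j) (_hε1 : ∀ j, εU j ≤ 1) (_hUε : ∀ (j : ℕ) (b : Bond d (towerP L m (j + 1))), ‖(UlevOf L m (n + 1) U j b : 𝔸) - 1‖ ≤ εU j)
        (_hLb : ∀ (j : ℕ) (b : Bond d (towerP L m (j + 1))), UlevOf L m (n + 1) U j b ∈ U1 𝔸)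
        (α : ℝ) (_hα : 0 ≤ α) (_hαle : α ≤ α₁)
        (hUst : ∀ b, star (U b : 𝔸) = (((U b)⁻¹ : 𝔸ˣ) : 𝔸)) (_hUb : ∀ b, U b ∈ U1 𝔸) (_hUη : ∀ b, ‖(U b : 𝔸) - 1‖ ≤ α * η)
        (_hUw : ∀ (x : TSite d (towerP L m (n + 1))) (μ ν : Fin d), ‖(U (shift ν x, μ) : 𝔸) - (U (x, μ) : 𝔸)‖ ≤ α * η ^ 2)
        (_hpl : ∀ p : B9SectCLatticeCarrier.Plaq d (towerP L m (n + 1)), ‖(plaqHolU U p : 𝔸) - 1‖ ≤ α * η ^ 2)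
        (_hUgrad : ∀ (x : TSite d (towerP L m (n + 1))) (μ : Fin d), ‖(U (x, μ) : 𝔸) - U (unshift μ x, μ)‖ ≤ α * η ^ 2)
        (_hRlev : ∀ (j : ℕ) (b : Bond d (towerP L m (j + 1))) (w : W), ‖adTransportW φ (UlevOf L m (n + 1) U j) b w‖ ≤ ‖w‖)
        (_hεg : ∀ j < n + 1, εU j ≤ α * ϱ ^ j) (_hAQ : ∑ j ∈ Finset.range (n + 1), αU j ≤ AQ)
        (hpos' : ∀ x : SiteL2K ℂ d (towerP L m (n + 1)) c₀ W, x ≠ 0 → 0 < RCLike.re ⟪x, laplacePrimeAk L m n φ η U a' (c₁ := c₁) x⟫_ℂ)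
        (hpos : ∀ x : BondL2K ℂ d (towerP L m (n + 1)) c₀ W, x ≠ 0 →
          0 < RCLike.re ⟪x, laplaceAk L m n φ η U hL αU hα1 hU1 hreg τ (c₀ := c₀) (c₁ := c₁) a x⟫_ℂ)
        (_hc₀η : c₀ = η ^ d) (j₀ : ℝ) (_hJ : ∀ μ y, ‖B9Eq39Adjoint.J (fun μ => B9Eq33CovDerivVector.shiftEquiv μ) (fun μ y => U (y, μ)) η μ y‖ ≤ j₀) (_hj : j₀ ≤ j₁)
        (hposπ : ∀ x : BondL2K ℂ d (towerP L m (n + 1)) c₀ W, x ≠ 0 →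
          0 < RCLike.re ⟪x, laplaceAkPi L m n φ τ η U a' hpos' hL αU hα1 hU1 hreg (c₁ := c₁) a x⟫_ℂ)
        (_hQ : Function.Surjective (QkW L m n φ U hL αU hα1 hU1 hreg (c₀ := c₀) (c₁ := c₁)))
        (hpos'₁ : ∀ x : SiteL2K ℂ d (towerP L m (n + 1)) c₀ W, x ≠ 0 →
          0 < RCLike.re ⟪x, laplacePrimeAk L m n φ η (fun _ : Bond d (towerP L m (n + 1)) => (1 : 𝔸ˣ)) a' (c₁ := c₁) x⟫_ℂ)
        (hpos₁ : ∀ x : BondL2K ℂ d (towerP L m (n + 1)) c₀ W, x ≠ 0 →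
          0 < RCLike.re ⟪x, laplaceAk L m n φ η (fun _ : Bond d (towerP L m (n + 1)) => (1 : 𝔸ˣ)) hL (fun _ => 0) (fun _ => by norm_num)
            (perCfg_UlevOf_one_mem_U1 L m (n + 1)) (norm_Wcx_UlevOf_one_sub_one_le L m (n + 1) (fun _ => 0) (fun _ => le_rfl)) τ
            (c₀ := c₀) (c₁ := c₁) a x⟫_ℂ)
        (v : TSite d m) (f : BondL2K ℂ d (towerP L m (n + 1)) c₀ W) (F : ℝ)
        (_hfv : ∀ b', blockCoord (L ^ (n + 1)) m (siteCast (towerP_eq_fineP_pow L m (n + 1)) (bpos b')) ≠ v → WL2.equiv ℂ (fun _ : Bond d (towerP L m (n + 1)) => c₀) W f b' = 0)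
        (_hfF : ∀ b', ‖WL2.equiv ℂ (fun _ : Bond d (towerP L m (n + 1)) => c₀) W f b'‖ ≤ F)
 (bd : Bond d (towerP L m (n + 1))),
        ‖WL2.equiv ℂ (fun _ : Bond d (towerP L m (n + 1)) => c₀) W
            (G1LatticeK hposπ (covDerivL2K ℂ c₀ ((η : ℂ))⁻¹ (adTransportW φ U) (RofUk L m n φ η U (c₀ := c₀)
                (covDivL2K ℂ c₀ ((η : ℂ))⁻¹ (adTransportW φ fun bb => (U bb)⁻¹) (G1LatticeK hposπ f)))) -
              G1k L m n φ η (fun _ : Bond d (towerP L m (n + 1)) => (1 : 𝔸ˣ)) hL (fun _ => 0) (fun _ => by norm_num)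
                (perCfg_UlevOf_one_mem_U1 L m (n + 1)) (norm_Wcx_UlevOf_one_sub_one_le L m (n + 1) (fun _ => 0) (fun _ => le_rfl)) τ (c₀ := c₀) (c₁ := c₁) hpos₁
                (covDerivL2K ℂ c₀ ((η : ℂ))⁻¹ (adTransportW φ (fun _ : Bond d (towerP L m (n + 1)) => (1 : 𝔸ˣ)))
                  (RofUk L m n φ η (fun _ : Bond d (towerP L m (n + 1)) => (1 : 𝔸ˣ)) (c₀ := c₀)
                    (covDivL2K ℂ c₀ ((η : ℂ))⁻¹ (adTransportW φ fun bb => ((fun _ : Bond d (towerP L m (n + 1)) => (1 : 𝔸ˣ)) bb)⁻¹)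
                      (G1k L m n φ η (fun _ : Bond d (towerP L m (n + 1)) => (1 : 𝔸ˣ)) hL (fun _ => 0) (fun _ => by norm_num)
                        (perCfg_UlevOf_one_mem_U1 L m (n + 1)) (norm_Wcx_UlevOf_one_sub_one_le L m (n + 1) (fun _ => 0) (fun _ => le_rfl)) τ (c₀ := c₀) (c₁ := c₁)
                        hpos₁ f))))) bd‖ ≤
          (j₀ + α) * K * Real.exp (-(κ * tdist m (blockCoord (L ^ (n + 1)) m (siteCast (towerP_eq_fineP_pow L m (n + 1)) (bpos bd))) v)) * F := by
  classical
  -- (0) the suppliers, `∃`-first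
  obtain ⟨αa, Ba, δa, hαa, hBa, hδa, HA⟩ :=
    rows_RkGpDstar_GpOfUk_hold hd L hL hL3 φ hMφ hMφ' hφ hφ' ha ha' hϱ0 hϱ1 τ hτ hCτ hMτ hρw hτ₁ hτ₂ hφτ AQ
  obtain ⟨αC, BC, δC, hαC, hBC, hδC, HC⟩ :=
    exists_hasMajorant_diffLetter_GpOfUk_sub_flat L φ hMφ hMφ' hφ hφ' ha' hϱ0 hϱ1 τ hτ₂ hφτ b hM₂ hrepr hd hL3
  obtain ⟨BG, δ₀, hBG, hδ₀, hbase⟩ := exists_hasMajorants_GpOfUk_one L φ (a' := a') hMφ hMφ' hφ hφ' ha' τ hτ₂ hφτ b hM₂ hrepr hd hL3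
  obtain ⟨αO, jO, KO, κO, hαO, hjO, hKO, hκO, HO⟩ :=
    exists_letter_RkGpDstar_sub_flat hd L hL hL3 φ hMφ hMφ' hφ hφ' hstar ha ha' hϱ0 hϱ1 τ hτ hCτ hτm hMτ hρw hτ₁ hτ₂ hφτ AQ b hM₂ hrepr
  set κ₀ : ℝ := min (min δa δC) (min δ₀ κO) with hκ₀
  have hκ₀0 : 0 < κ₀ := lt_min (lt_min hδa hδC) (lt_min hδ₀ hκO)
  have hκ₀a : κ₀ ≤ δa := (min_le_left _ _).trans (min_le_left _ _)
  have hκ₀C : κ₀ ≤ δC := (min_le_left _ _).trans (min_le_right _ _)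
  have hκ₀G : κ₀ ≤ δ₀ := (min_le_right _ _).trans (min_le_left _ _)
  have hκ₀O : κ₀ ≤ κO := (min_le_right _ _).trans (min_le_right _ _)
  set S : ℝ := latticeConst d (κ₀ / 2) with hS
  have hS0 : 0 ≤ S := latticeConst_nonneg d (half_pos hκ₀0).le
  have hSb : 0 ≤ ∑ i, ‖b i‖ := Finset.sum_nonneg fun i _ => norm_nonneg _
  set KC' : ℝ := Mφ' * ((∑ i, ‖b i‖) * M₂ * BC) * Mφ with hKC'
  have hKC'0 : 0 ≤ KC' := by positivity
  set KG' : ℝ := Mφ' * ((∑ i, ‖b i‖) * M₂ * BG) * Mφ with hKG'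
  have hKG'0 : 0 ≤ KG' := by positivity
  set K : ℝ := 2 * Mφ * Mφ' * Ba * Real.exp (κ₀ / 2) + Ba * KC' * S + KO * KG' * S with hK
  have hK0 : 0 ≤ K := by positivity
  refine ⟨min (min αa αC) (min αO 1), min αa jO, K, κ₀ / 2,
    lt_min (lt_min hαa hαC) (lt_min hαO one_pos), lt_min hαa hjO, hK0, half_pos hκ₀0, ?_⟩
  intro n η hηL c₀ c₁ _ _ hw hρ m _ hm U αU hα0 hα1 hαL hU1 hreg εU hεU hε1 hUε hLb α hα hαle hUst hUb hUη hUw hpl hUgrad hRlev hεg hAQ hpos' hpos hc₀η j₀ hJ hj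
    hposπ hQ hpos'₁ hpos₁ v f F hfv hfF bd
  have hαa' : α ≤ αa := hαle.trans ((min_le_left _ _).trans (min_le_left _ _))
  have hαC' : α ≤ αC := hαle.trans ((min_le_left _ _).trans (min_le_right _ _))
  have hαO' : α ≤ αO := hαle.trans ((min_le_right _ _).trans (min_le_left _ _))
  have hja' : j₀ ≤ αa := hj.trans (min_le_left _ _)
  have hjO' : j₀ ≤ jO := hj.trans (min_le_right _ _)
  have hc₀ : (0 : ℝ) < c₀ := Fact.out
  haveI : Nonempty (Bond d (towerP L m (n + 1))) := ⟨bd⟩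
  haveI : Nonempty (TSite d (towerP L m (n + 1))) := ⟨bpos bd⟩
  have y₀ : TSite d (towerP L m (n + 1)) := fun _ => 0
  haveI : Nonempty (Bond d m) := ⟨(v, ⟨0, hd⟩)⟩
  have hF : 0 ≤ F := (norm_nonneg _).trans (hfF bd)
  have hj₀ : 0 ≤ j₀ := (norm_nonneg _).trans (hJ ⟨0, hd⟩ y₀)
  have hAQ0 : 0 ≤ AQ := (Finset.sum_nonneg fun j _ => hα0 j).trans hAQ
  have hLpos : (0 : ℝ) < (L : ℝ) ^ (n + 1) := pow_pos (by exact_mod_cast Nat.pos_of_ne_zero (NeZero.ne L)) _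
  have hη : 0 < η := by
    by_contra h; push Not at h; nlinarith [mul_nonpos_of_nonpos_of_nonneg h hLpos.le]
  have hcn : ‖((η : ℂ))⁻¹‖ = η⁻¹ := by rw [norm_inv, Complex.norm_real, Real.norm_eq_abs, abs_of_pos hη]
  have hlen1 : ∀ a'' : (towerGeom L m n η 0).Site, (towerGeom L m n η 0).len a'' = 1 := fun a'' => by rw [len_towerGeom, mul_comm]; exact hηL
  -- the enlarged radius for the owner's α-convention rows
  set α' : ℝ := max α j₀ with hα'
  have hα'0 : 0 ≤ α' := hα.trans (le_max_left _ _)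
  have hαα' : α ≤ α' := le_max_left _ _
  have hα'a : α' ≤ αa := max_le hαa' hja'
  have hUη' : ∀ b', ‖(U b' : 𝔸) - 1‖ ≤ α' * η := fun b' => (hUη b').trans (by gcongr)
  have hpl' : ∀ p : B9SectCLatticeCarrier.Plaq d (towerP L m (n + 1)), ‖(plaqHolU U p : 𝔸) - 1‖ ≤ α' * η ^ 2 := fun p => (hpl p).trans (by gcongr)
  have hUgrad' : ∀ (x : TSite d (towerP L m (n + 1))) (μ' : Fin d), ‖(U (x, μ') : 𝔸) - U (unshift μ' x, μ')‖ ≤ α' * η ^ 2 := fun x μ' =>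
    (hUgrad x μ').trans (by gcongr)
  have hεg' : ∀ j < n + 1, εU j ≤ α' * ϱ ^ j := fun j hj' => (hεg j hj').trans (mul_le_mul_of_nonneg_right hαα' (pow_nonneg hϱ0 j))
  have hJ' : ∀ (μ' : Fin d) (y' : TSite d (towerP L m (n + 1))),
      ‖B9Eq39Adjoint.J (fun μ => B9Eq33CovDerivVector.shiftEquiv μ) (fun μ y => U (y, μ)) η μ' y'‖ ≤ α' := fun μ' y' => (hJ μ' y').trans (le_max_right _ _)
  -- the flat data
  have hαL1 : ∀ j : ℕ, 50 * (d + 1) * (fun _ : ℕ => (0 : ℝ)) j * (L : ℝ) ^ d ≤ 1 / 2 := fun _ => by norm_num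
  have hUst1 : ∀ b' : Bond d (towerP L m (n + 1)), star ((fun _ : Bond d (towerP L m (n + 1)) => (1 : 𝔸ˣ)) b' : 𝔸) = ((((fun _ : Bond d (towerP L m (n + 1)) => (1 : 𝔸ˣ)) b')⁻¹ : 𝔸ˣ) : 𝔸) := fun _ => by simp
  have hUb1 : ∀ b' : Bond d (towerP L m (n + 1)), (fun _ : Bond d (towerP L m (n + 1)) => (1 : 𝔸ˣ)) b' ∈ U1 𝔸 := fun _ => one_mem _
  have hposπ₁ := (laplaceAkPi_one_pos_iff L m n φ τ η a' hpos'₁ hL (fun _ => 0) (fun _ => by norm_num)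
    (perCfg_UlevOf_one_mem_U1 L m (n + 1)) (norm_Wcx_UlevOf_one_sub_one_le L m (n + 1) (fun _ => 0) (fun _ => le_rfl)) a (c₀ := c₀)).mpr hpos₁
  have hQ1 := QkW_surjective L m n φ (fun _ : Bond d (towerP L m (n + 1)) => (1 : 𝔸ˣ)) hL (fun _ => 0) (fun _ => by norm_num)
    (perCfg_UlevOf_one_mem_U1 L m (n + 1)) (norm_Wcx_UlevOf_one_sub_one_le L m (n + 1) (fun _ => 0) (fun _ => le_rfl)) (c₀ := c₀) (c₁ := c₁) hαL1
  -- names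
  set piS : TSite d (towerP L m (n + 1)) → TSite d m := fun x => blockCoord (L ^ (n + 1)) m (siteCast (towerP_eq_fineP_pow L m (n + 1)) x) with hpiS
  set piB : Bond d (towerP L m (n + 1)) → TSite d m := fun b' => piS (bpos b') with hpiB
  set Gt := G1LatticeK hposπ with hGt
  set G1 := G1k L m n φ η (fun _ : Bond d (towerP L m (n + 1)) => (1 : 𝔸ˣ)) hL (fun _ => 0) (fun _ => by norm_num)
                (perCfg_UlevOf_one_mem_U1 L m (n + 1)) (norm_Wcx_UlevOf_one_sub_one_le L m (n + 1) (fun _ => 0) (fun _ => le_rfl)) τ (c₀ := c₀) (c₁ := c₁) hpos₁ with hG1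
  -- (`G′_k(U)`, `G′_k(1)` are NOT abbreviated: they sit inside the implicit slots of `G1LatticeK hposπ`)
  set RU := RofUk L m n φ η U (c₀ := c₀) with hRU
  set R1 := RofUk L m n φ η (fun _ : Bond d (towerP L m (n + 1)) => (1 : 𝔸ˣ)) (c₀ := c₀) with hR1
  set DsU := covDivL2K ℂ c₀ ((η : ℂ))⁻¹ (adTransportW φ fun bb => (U bb)⁻¹) with hDsU
  set Ds1 := covDivL2K ℂ c₀ ((η : ℂ))⁻¹ (adTransportW φ fun bb => ((fun _ : Bond d (towerP L m (n + 1)) => (1 : 𝔸ˣ)) bb)⁻¹) with hDs1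
  set DU := covDerivL2K ℂ c₀ ((η : ℂ))⁻¹ (adTransportW φ U) with hDU
  set D1 := covDerivL2K ℂ c₀ ((η : ℂ))⁻¹ (adTransportW φ (fun _ : Bond d (towerP L m (n + 1)) => (1 : 𝔸ˣ))) with hD1
  -- the CLMs
  obtain ⟨Tω, hTω⟩ : ∃ T : BondL2K ℂ d (towerP L m (n + 1)) c₀ W →L[ℂ] SiteL2K ℂ d (towerP L m (n + 1)) c₀ W, T = LinearMap.toContinuousLinearMap (RU ∘ₗ (GpOfUk L m n φ η U a' (c₁ := c₁) hpos') ∘ₗ DsU) := ⟨_, rfl⟩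
  obtain ⟨TOd, hTOd⟩ : ∃ T : BondL2K ℂ d (towerP L m (n + 1)) c₀ W →L[ℂ] SiteL2K ℂ d (towerP L m (n + 1)) c₀ W,
      T = LinearMap.toContinuousLinearMap (RU ∘ₗ (GpOfUk L m n φ η U a' (c₁ := c₁) hpos') ∘ₗ DsU - R1 ∘ₗ (GpOfUk L m n φ η (fun _ : Bond d (towerP L m (n + 1)) => (1 : 𝔸ˣ)) a' (c₁ := c₁) hpos'₁) ∘ₗ Ds1) := ⟨_, rfl⟩
  obtain ⟨TCd, hTCd⟩ : ∃ T : SiteL2K ℂ d (towerP L m (n + 1)) c₀ W →L[ℂ] BondL2K ℂ d (towerP L m (n + 1)) c₀ W, T = LinearMap.toContinuousLinearMap (D1 ∘ₗ ((GpOfUk L m n φ η U a' (c₁ := c₁) hpos') - (GpOfUk L m n φ η (fun _ : Bond d (towerP L m (n + 1)) => (1 : 𝔸ˣ)) a' (c₁ := c₁) hpos'₁))) := ⟨_, rfl⟩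
  obtain ⟨TGd, hTGd⟩ : ∃ T : SiteL2K ℂ d (towerP L m (n + 1)) c₀ W →L[ℂ] BondL2K ℂ d (towerP L m (n + 1)) c₀ W, T = LinearMap.toContinuousLinearMap (D1 ∘ₗ (GpOfUk L m n φ η (fun _ : Bond d (towerP L m (n + 1)) => (1 : 𝔸ˣ)) a' (c₁ := c₁) hpos'₁)) := ⟨_, rfl⟩
  -- (1) the letters at the common rate `κ₀`
  have hweak : ∀ {r' : ℝ} (t : ℝ), κ₀ ≤ r' → 0 ≤ t → Real.exp (-(r' * t)) ≤ Real.exp (-(κ₀ * t)) := fun t hr ht => Real.exp_le_exp.mpr (by nlinarith)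
  have hexpS : ∀ {r' : ℝ} (x : TSite d (towerP L m (n + 1))) (w : TSite d m), κ₀ ≤ r' → 0 ≤ r' →
      Real.exp (-(r' * (towerGeom L m n η 0).dist (blkK L m n x) w)) ≤ Real.exp (-(κ₀ * tdist m (piS x) w)) := by
    intro r' x w hr hr0
    rw [dist_towerGeom, blkK_eq_blockCoord_siteCast]
    refine Real.exp_le_exp.mpr ?_
    have h1 := tdist_le_tdist1 (blockCoord (L ^ (n + 1)) m (siteCast (towerP_eq_fineP_pow L m (n + 1)) x)) w
    have h2 := tdist_nonneg m (blockCoord (L ^ (n + 1)) m (siteCast (towerP_eq_fineP_pow L m (n + 1)) x)) w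
    nlinarith [mul_le_mul_of_nonneg_right hr h2, mul_le_mul_of_nonneg_left h1 hr0]
  -- (L)(ω(U) = R_kG′_kD*_U; Ba, κ₀): (HR) conjunct 1 at the radius `α′`
  have hLω : ∀ (w : TSite d m) (g : BondL2K ℂ d (towerP L m (n + 1)) c₀ W) (G : ℝ), (∀ x, piB x ≠ w → WL2.equiv ℂ (fun _ : Bond d (towerP L m (n + 1)) => c₀) W g x = 0) →
      (∀ x, ‖WL2.equiv ℂ (fun _ : Bond d (towerP L m (n + 1)) => c₀) W g x‖ ≤ G) → ∀ x, ‖WL2.equiv ℂ (fun _ : TSite d (towerP L m (n + 1)) => c₀) W (Tω g) x‖ ≤ Ba * Real.exp (-(κ₀ * tdist m (piS x) w)) * G := by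
    intro w g G hgv hgG x
    have hG : 0 ≤ G := (norm_nonneg _).trans (hgG bd)
    rw [hTω, LinearMap.coe_toContinuousLinearMap', LinearMap.comp_apply, LinearMap.comp_apply]
    refine ((HA n η hηL c₀ c₁ hw hρ m hm U αU hα0 hα1 hU1 hreg εU hεU hUε hLb α' hα'0 hα'a hUst hUb hUη' hpl' hUgrad' hRlev hεg' hAQ hpos' hpos hposπ hc₀η hJ'
      w g G hgv hgG).1 x).trans ?_
    exact mul_le_mul_of_nonneg_right (mul_le_mul_of_nonneg_left (hweak _ hκ₀a (tdist_nonneg m _ _)) hBa) hG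
  -- (L)(D_1(G′_k(U) − G′_k(1)); KC′·α, κ₀): the gradient ladder read back
  have hLCd : ∀ (w : TSite d m) (h : SiteL2K ℂ d (towerP L m (n + 1)) c₀ W) (H : ℝ), (∀ x, piS x ≠ w → WL2.equiv ℂ (fun _ : TSite d (towerP L m (n + 1)) => c₀) W h x = 0) →
      (∀ x, ‖WL2.equiv ℂ (fun _ : TSite d (towerP L m (n + 1)) => c₀) W h x‖ ≤ H) → ∀ b', ‖WL2.equiv ℂ (fun _ : Bond d (towerP L m (n + 1)) => c₀) W (TCd h) b'‖ ≤ (KC' * α) * Real.exp (-(κ₀ * tdist m (piB b') w)) * H := by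
    intro w h H hhv hhH b'
    obtain ⟨x, μ⟩ := b'
    have hH : 0 ≤ H := (norm_nonneg _).trans (hhH x)
    have hoff' : ∀ x', blkK L m n x' ≠ w → WL2.equiv ℂ (fun _ : TSite d (towerP L m (n + 1)) => c₀) W h x' = 0 := fun x' hx' =>
      hhv x' (by rw [blkK_eq_blockCoord_siteCast] at hx'; exact hx')
    have hbd' : ∀ x', blkK L m n x' = w → ‖WL2.equiv ℂ (fun _ : TSite d (towerP L m (n + 1)) => c₀) W h x'‖ ≤ H := fun x' _ => hhH x'
    have hT := HC n η hηL c₀ c₁ hw m U α hα hαC' hUb hUη hUw εU hεU hε1 hεg hUε hLb hpos' hpos'₁ 0 0 True (Sum.inl μ)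
    rw [diffLetter_inl, ← conj_sub, ← readA_sub, ← B9Eq352DivFormLetters.conj_mul] at hT
    have hrow := gradRowW_of_hasMajorant_conj_gradLetterF_readA φ hMφ hMφ' hφ hφ' b hM₂ hrepr (G := toB6 (towerGeom L m n η 0) 0 True) (blkK L m n)
      _ _ μ _ hT w h H hH hoff' hbd' x
    rw [hTCd, LinearMap.coe_toContinuousLinearMap', LinearMap.comp_apply]
    refine hrow.trans ?_
    have hx : piB (x, μ) = piS x := rfl
    rw [hx]
    have hexp := hexpS x w hκ₀C hδC.le
    calc Mφ' * ((∑ i, ‖b i‖) * M₂ * (BC * α * Real.exp (-(δC * (towerGeom L m n η 0).dist (blkK L m n x) w)))) * (Mφ * H)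
        ≤ Mφ' * ((∑ i, ‖b i‖) * M₂ * (BC * α * Real.exp (-(κ₀ * tdist m (piS x) w)))) * (Mφ * H) := by gcongr
      _ = (KC' * α) * Real.exp (-(κ₀ * tdist m (piS x) w)) * H := by rw [hKC']; ring
  -- (L)(ω(U) − ω(1); (j₀+α)·KO, κ₀): this generation's letter
  have hLOd : ∀ (w : TSite d m) (g : BondL2K ℂ d (towerP L m (n + 1)) c₀ W) (G : ℝ), (∀ x, piB x ≠ w → WL2.equiv ℂ (fun _ : Bond d (towerP L m (n + 1)) => c₀) W g x = 0) →
      (∀ x, ‖WL2.equiv ℂ (fun _ : Bond d (towerP L m (n + 1)) => c₀) W g x‖ ≤ G) → ∀ x, ‖WL2.equiv ℂ (fun _ : TSite d (towerP L m (n + 1)) => c₀) W (TOd g) x‖ ≤ ((j₀ + α) * KO) * Real.exp (-(κ₀ * tdist m (piS x) w)) * G := by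
    intro w g G hgv hgG x
    have hG : 0 ≤ G := (norm_nonneg _).trans (hgG bd)
    rw [hTOd, LinearMap.coe_toContinuousLinearMap', LinearMap.sub_apply, LinearMap.comp_apply, LinearMap.comp_apply, LinearMap.comp_apply, LinearMap.comp_apply]
    refine (HO n η hηL c₀ c₁ hw hρ m hm U αU hα0 hα1 hαL hU1 hreg εU hεU hε1 hUε hLb α hα hαO' hUst hUb hUη hUw hpl hUgrad hRlev hεg hAQ hpos' hpos hc₀η j₀ hJ hjO'
      hposπ hQ hpos'₁ hpos₁ w g G hgv hgG x).trans ?_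
    exact mul_le_mul_of_nonneg_right (mul_le_mul_of_nonneg_left (hweak _ hκ₀O (tdist_nonneg m _ _)) (mul_nonneg (add_nonneg hj₀ hα) hKO)) hG
  -- (L)(D_1G′_k(1); KG′, κ₀): the flat-base gradient majorant read back
  obtain ⟨-, h342_2, -⟩ := hbase n η hηL c₀ c₁ hw m hpos'₁ 0 0 True
  have hLGd : ∀ (w : TSite d m) (h : SiteL2K ℂ d (towerP L m (n + 1)) c₀ W) (H : ℝ), (∀ x, piS x ≠ w → WL2.equiv ℂ (fun _ : TSite d (towerP L m (n + 1)) => c₀) W h x = 0) →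
      (∀ x, ‖WL2.equiv ℂ (fun _ : TSite d (towerP L m (n + 1)) => c₀) W h x‖ ≤ H) → ∀ b', ‖WL2.equiv ℂ (fun _ : Bond d (towerP L m (n + 1)) => c₀) W (TGd h) b'‖ ≤ KG' * Real.exp (-(κ₀ * tdist m (piB b') w)) * H := by
    intro w h H hhv hhH b'
    obtain ⟨x, μ⟩ := b'
    have hH : 0 ≤ H := (norm_nonneg _).trans (hhH x)
    have hoff' : ∀ x', blkK L m n x' ≠ w → WL2.equiv ℂ (fun _ : TSite d (towerP L m (n + 1)) => c₀) W h x' = 0 := fun x' hx' =>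
      hhv x' (by rw [blkK_eq_blockCoord_siteCast] at hx'; exact hx')
    have hbd' : ∀ x', blkK L m n x' = w → ‖WL2.equiv ℂ (fun _ : TSite d (towerP L m (n + 1)) => c₀) W h x'‖ ≤ H := fun x' _ => hhH x'
    have hT := h342_2 (Sum.inl μ)
    rw [diffLetter_inl, ← B9Eq352DivFormLetters.conj_mul] at hT
    have hrow := gradRowW_of_hasMajorant_conj_gradLetterF_readA φ hMφ hMφ' hφ hφ' b hM₂ hrepr (G := toB6 (towerGeom L m n η 0) 0 True) (blkK L m n)
      _ _ μ _ hT w h H hH hoff' hbd' x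
    rw [hTGd, LinearMap.coe_toContinuousLinearMap', LinearMap.comp_apply]
    refine hrow.trans ?_
    have hx : piB (x, μ) = piS x := rfl
    rw [hx]
    have hexp := hexpS x w hκ₀G hδ₀.le
    calc Mφ' * ((∑ i, ‖b i‖) * M₂ * (BG * (towerGeom L m n η 0).len (blkK L m n x) * Real.exp (-(δ₀ * (towerGeom L m n η 0).dist (blkK L m n x) w)))) * (Mφ * H)
        = Mφ' * ((∑ i, ‖b i‖) * M₂ * (BG * Real.exp (-(δ₀ * (towerGeom L m n η 0).dist (blkK L m n x) w)))) * (Mφ * H) := by rw [hlen1, mul_one]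
      _ ≤ Mφ' * ((∑ i, ‖b i‖) * M₂ * (BG * Real.exp (-(κ₀ * tdist m (piS x) w)))) * (Mφ * H) := by gcongr
      _ = KG' * Real.exp (-(κ₀ * tdist m (piS x) w)) * H := by rw [hKG']; ring
  -- (2) the two composed words
  have hrow : ∀ w : TSite d m, ∑ u, Real.exp (-((κ₀ - κ₀ / 2) * tdist m w u)) ≤ S := fun w => by
    rw [show κ₀ - κ₀ / 2 = κ₀ / 2 by ring]; exact torusSum_le d hm (half_pos hκ₀0) w
  have hδ0 : ∀ u v : TSite d m, 0 ≤ tdist m u v := fun u v => tdist_nonneg _ _ _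
  have hδt : ∀ u y v : TSite d m, tdist m u v ≤ tdist m u y + tdist m y v := fun u y v => tdist_triangle hm u y v
  have hκ'0 : (0 : ℝ) ≤ κ₀ / 2 := by positivity
  have hκ'1 : κ₀ / 2 ≤ κ₀ := by linarith
  have hW2 := letter_comp (𝕜 := ℂ) (tdist m) piB piS piB Tω TCd hδ0 hδt hBa (mul_nonneg hKC'0 hα) hκ'0 hκ'1 hLω hLCd hrow
  have hW3 := letter_comp (𝕜 := ℂ) (tdist m) piB piS piB TOd TGd hδ0 hδt (mul_nonneg (add_nonneg hj₀ hα) hKO) hKG'0 hκ'0 hκ'1 hLOd hLGd hrow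
  have hW23 := letter_add (𝕜 := ℂ) (tdist m) piB piB _ _ hW2 hW3 v f F hfv hfF bd
  -- (3) the transporter difference on the value row of `u(U)` at the tip, re-blocked to the base
  obtain ⟨uU, huU⟩ : ∃ u : SiteL2K ℂ d (towerP L m (n + 1)) c₀ W, u = (GpOfUk L m n φ η U a' (c₁ := c₁) hpos') (RU ((GpOfUk L m n φ η U a' (c₁ := c₁) hpos') (DsU f))) := ⟨_, rfl⟩
  set DB : ℝ := tdist m (piB bd) v with hDB
  set DT : ℝ := tdist m (piS (btgt bd)) v with hDT
  have hDB0 : 0 ≤ DB := tdist_nonneg _ _ _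
  have hDT0 : 0 ≤ DT := tdist_nonneg _ _ _
  have hu : ‖WL2.equiv ℂ (fun _ : TSite d (towerP L m (n + 1)) => c₀) W uU (btgt bd)‖ ≤ Ba * Real.exp (-(κ₀ / 2 * DT)) * F := by
    rw [huU]
    refine ((HA n η hηL c₀ c₁ hw hρ m hm U αU hα0 hα1 hU1 hreg εU hεU hUε hLb α' hα'0 hα'a hUst hUb hUη' hpl' hUgrad' hRlev hεg' hAQ hpos' hpos hposπ hc₀η hJ'
      v f F hfv hfF).2.2.1 (btgt bd)).trans ?_
    have hκt : Real.exp (-(κ₀ * DT)) ≤ Real.exp (-(κ₀ / 2 * DT)) := Real.exp_le_exp.mpr (by linarith [mul_nonneg hκ₀0.le hDT0])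
    exact mul_le_mul_of_nonneg_right (mul_le_mul_of_nonneg_left ((hweak _ hκ₀a hDT0).trans hκt) hBa) hF
  have hRε : ∀ w : W, ‖adTransportW φ U bd w - w‖ ≤ 2 * Mφ * Mφ' * (α * η) * ‖w‖ := fun w => by
    have h := norm_adTransportW_sub_adTransportW_le φ hφ hφ' hMφ' U (fun _ : Bond d (towerP L m (n + 1)) => (1 : 𝔸ˣ)) bd bd (hUb bd) (hUb1 bd) w
    rw [B5Eq172HodgePositivity.adTransportW_one, LinearMap.id_apply, Units.val_one] at h
    exact h.trans (by gcongr; exact hUη bd)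
  have hreblock : Real.exp (-(κ₀ / 2 * DT)) ≤ Real.exp (κ₀ / 2) * Real.exp (-(κ₀ / 2 * DB)) := by
    rw [← Real.exp_add]
    have htri : DB ≤ DT + 1 := by
      have h1 := tdist_triangle hm (blockCoord (L ^ (n + 1)) m (siteCast (towerP_eq_fineP_pow L m (n + 1)) (bpos bd)))
        (blockCoord (L ^ (n + 1)) m (siteCast (towerP_eq_fineP_pow L m (n + 1)) (btgt bd))) v
      have h2 := tdist_bigBlock_bpos_btgt_le_one L m (n + 1) hm bd
      have e1 : DB = tdist m (blockCoord (L ^ (n + 1)) m (siteCast (towerP_eq_fineP_pow L m (n + 1)) (bpos bd))) v := rfl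
      have e2 : DT = tdist m (blockCoord (L ^ (n + 1)) m (siteCast (towerP_eq_fineP_pow L m (n + 1)) (btgt bd))) v := rfl
      rw [e1, e2]; linarith
    exact Real.exp_le_exp.mpr (by linarith [mul_le_mul_of_nonneg_left htri hκ'0])
  have hT1 : ‖WL2.equiv ℂ (fun _ : Bond d (towerP L m (n + 1)) => c₀) W (DU uU - D1 uU) bd‖ ≤ α * (2 * Mφ * Mφ' * Ba * Real.exp (κ₀ / 2)) * Real.exp (-(κ₀ / 2 * DB)) * F := by
    have e : WL2.equiv ℂ (fun _ : Bond d (towerP L m (n + 1)) => c₀) W (DU uU - D1 uU) bd =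
        ((η : ℂ))⁻¹ • (adTransportW φ U bd (WL2.equiv ℂ (fun _ : TSite d (towerP L m (n + 1)) => c₀) W uU (btgt bd)) -
          WL2.equiv ℂ (fun _ : TSite d (towerP L m (n + 1)) => c₀) W uU (btgt bd)) := by
      rw [WL2.equiv_sub, Pi.sub_apply, hDU, hD1, equiv_covDerivL2K, equiv_covDerivL2K, covDeriv_apply, covDeriv_apply, B5Eq172HodgePositivity.adTransportW_one,
        LinearMap.id_apply, ← smul_sub]
      congr 1
      abel
    rw [e, norm_smul, hcn]
    calc η⁻¹ * ‖adTransportW φ U bd (WL2.equiv ℂ (fun _ : TSite d (towerP L m (n + 1)) => c₀) W uU (btgt bd)) - WL2.equiv ℂ (fun _ : TSite d (towerP L m (n + 1)) => c₀) W uU (btgt bd)‖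
        ≤ η⁻¹ * (2 * Mφ * Mφ' * (α * η) * (Ba * Real.exp (-(κ₀ / 2 * DT)) * F)) := by
          refine mul_le_mul_of_nonneg_left ((hRε _).trans ?_) (inv_nonneg.2 hη.le)
          exact mul_le_mul_of_nonneg_left hu (by positivity)
      _ = 2 * Mφ * Mφ' * α * Ba * Real.exp (-(κ₀ / 2 * DT)) * F * (η⁻¹ * η) := by ring
      _ = 2 * Mφ * Mφ' * α * Ba * Real.exp (-(κ₀ / 2 * DT)) * F := by rw [inv_mul_cancel₀ hη.ne', mul_one]
      _ ≤ 2 * Mφ * Mφ' * α * Ba * (Real.exp (κ₀ / 2) * Real.exp (-(κ₀ / 2 * DB))) * F := by gcongr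
      _ = α * (2 * Mφ * Mφ' * Ba * Real.exp (κ₀ / 2)) * Real.exp (-(κ₀ / 2 * DB)) * F := by ring
  -- (4) (3.152) at `U` and at `1`, `G̃_k(1) = G_k(1)`, and the telescoping identity
  have e1 : Gt (DU (RU (DsU (Gt f)))) = DU uU := by
    rw [huU]; exact thirdWord_G1LatticeKPi_eq L m n φ τ hτ₁ hτ₂ hφτ η U hUst a' hpos' hL αU hα1 hU1 hreg a hposπ f
  have e2 := thirdWord_G1LatticeKPi_eq L m n φ τ hτ₁ hτ₂ hφτ η (fun _ : Bond d (towerP L m (n + 1)) => (1 : 𝔸ˣ)) hUst1 a' hpos'₁ hL (fun _ => 0) (fun _ => by norm_num)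
    (perCfg_UlevOf_one_mem_U1 L m (n + 1)) (norm_Wcx_UlevOf_one_sub_one_le L m (n + 1) (fun _ => 0) (fun _ => le_rfl)) a hposπ₁ f
  have e3 : G1LatticeK hposπ₁ = G1 :=
    (letters_laplaceAkPi_one L m n φ τ η a' hpos'₁ hL (fun _ => 0) (fun _ => by norm_num)
      (perCfg_UlevOf_one_mem_U1 L m (n + 1)) (norm_Wcx_UlevOf_one_sub_one_le L m (n + 1) (fun _ => 0) (fun _ => le_rfl)) a hposπ₁ hpos₁ hQ1).1
  rw [e3] at e2
  have e2' : G1 (D1 (R1 (Ds1 (G1 f)))) = D1 ((GpOfUk L m n φ η (fun _ : Bond d (towerP L m (n + 1)) => (1 : 𝔸ˣ)) a' (c₁ := c₁) hpos'₁) (R1 ((GpOfUk L m n φ η (fun _ : Bond d (towerP L m (n + 1)) => (1 : 𝔸ˣ)) a' (c₁ := c₁) hpos'₁) (Ds1 f)))) := e2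
  rw [e1, e2']
  have hsplit : DU uU - D1 ((GpOfUk L m n φ η (fun _ : Bond d (towerP L m (n + 1)) => (1 : 𝔸ˣ)) a' (c₁ := c₁) hpos'₁) (R1 ((GpOfUk L m n φ η (fun _ : Bond d (towerP L m (n + 1)) => (1 : 𝔸ˣ)) a' (c₁ := c₁) hpos'₁) (Ds1 f)))) = (DU uU - D1 uU) + ((TCd ∘L Tω) + (TGd ∘L TOd)) f := by
    simp only [add_apply, ContinuousLinearMap.coe_comp, Function.comp_apply]
    rw [hTCd, hTω, hTGd, hTOd, huU]
    simp only [LinearMap.coe_toContinuousLinearMap']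
    simp only [LinearMap.sub_apply, LinearMap.comp_apply, map_sub]
    abel
  rw [hsplit, WL2.equiv_add, Pi.add_apply]
  refine (norm_add_le _ _).trans ((add_le_add hT1 hW23).trans ?_)
  -- (5) the constants
  have hE0 : 0 ≤ Real.exp (-(κ₀ / 2 * DB)) := Real.exp_nonneg _
  have hX1 : 0 ≤ 2 * Mφ * Mφ' * Ba * Real.exp (κ₀ / 2) := by positivity
  have hX2 : 0 ≤ Ba * KC' * S := by positivity
  have h1 : α * (2 * Mφ * Mφ' * Ba * Real.exp (κ₀ / 2)) ≤ (j₀ + α) * (2 * Mφ * Mφ' * Ba * Real.exp (κ₀ / 2)) := by nlinarith [mul_nonneg hj₀ hX1]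
  have h2 : Ba * (KC' * α) * S ≤ (j₀ + α) * (Ba * KC' * S) := by
    have e : Ba * (KC' * α) * S = α * (Ba * KC' * S) := by ring
    rw [e]; nlinarith [mul_nonneg hj₀ hX2]
  have h3 : (j₀ + α) * KO * KG' * S = (j₀ + α) * (KO * KG' * S) := by ring
  have hKexp : (j₀ + α) * K = (j₀ + α) * (2 * Mφ * Mφ' * Ba * Real.exp (κ₀ / 2)) + (j₀ + α) * (Ba * KC' * S) + (j₀ + α) * (KO * KG' * S) := by rw [hK]; ring
  have hsum : α * (2 * Mφ * Mφ' * Ba * Real.exp (κ₀ / 2)) + (Ba * (KC' * α) * S + (j₀ + α) * KO * KG' * S) ≤ (j₀ + α) * K := by rw [hKexp, h3]; linarith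
  have hfin := mul_le_mul_of_nonneg_right (mul_le_mul_of_nonneg_right hsum hE0) hF
  refine le_trans (le_of_eq ?_) hfin
  ring

end Literature.MathematicalPhysics.QuantumFieldTheory.Balaban1983to89.B9Eq3152ThirdWordPiTwoBackgroundLetterTower

end
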